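import Summits.BirchSwinnertonDyer.Rank1Residual.Ordinary.Conjectures.KolyvaginKimDatumOfCanonicalStructure
import Summits.BirchSwinnertonDyer.Rank1Residual.GaloisImage.KolyvaginSystemOfEulerSystemTorsionCoeffThree
import HarnessLib

/-!
# The Kolyvagin-class datum from an EULER SYSTEM of `T_3E` over the cyclotomic levels: C-16's chain composed with the
# tree's «Euler system ⇒ Kolyvagin system» THEOREM D (team n1011) — theorems only; nothing asserted; C-16 stays a CONJECTURE

HONEST FRAMING (cell `b2b-bsdres`, run/shared/lean/b2b/bsd-rank1-residual/, verbatim in every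
file): the goal of the cell is to DELETE the COMBINATION-SHAPED residual classes of the
Birch–Swinnerton-Dyer formula for ALL analytic-rank `≤ 1` elliptic curves over `ℚ` — "full BSD
formula for every rank `≤ 1` curve in class `C`" assembled STRICTLY from published theorems — so
that the rank-`≤ 1` remainder becomes exactly the CONSTRUCTION-SHAPED classes, which are TYPED
(missing-input `Prop`s), NOT attempted. This is not "finishing BSD". Seat `b2b-bsdres-additive-p3`
(X8 prover B / X7 joint; typer-designate for the cell conjecture C-16 = hyp C120.1; ladder BSD:K3 hand-off to cell
`bsd-ssimc`, last generation before the D-0075 sunset). This file books nothing and moves no mark; X7 / X8 stay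
CONSTRUCTION-SHAPED; C-16 = CONJECTURE. NO Euler system is asserted to exist (binder `hc`).

## What this file does

`KolyvaginKimDatumOfCanonicalStructure.lean` (F30) derives C-16's ONE residual input `KolyvaginKimDatum` (F25) from a
Kolyvagin system `κ` with `D.IsKolyvaginSystem (propagatedSelmerStructure W p k) κ` for THE CANONICAL datum `D` — which is
the output TYPE of team n1011's THEOREM D. This file performs the composition at `p = 3`:

* §1 **`kolyvaginKimDatum_of_isEulerSystem_torsionCoeff`** — `KolyvaginKimDatum W f 3 ℓ k₀ (k+1) Q vℓ v₃ ψ` from an EULER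
  SYSTEM `c` of `T_3E` over the cyclotomic levels `ℚ(μ_{3^{n+1}}, μ_r)` (`IsEulerSystem (cyclotomicLevelsRat 3 S) T_3E 3 c`;
  Kato's is the intended instance — a BINDER, nothing asserted) by n1011's THEOREM D
  `Derivative.Rat.exists_isKolyvaginSystem_propagatedSelmerStructure_three_of_torsion_eq_zero_torsionCoeff`
  (`GaloisImage/KolyvaginSystemOfEulerSystemTorsionCoeffThree.lean`; Mazur–Rubin Thm. 3.2.4 / App. A at `3` for
  `𝓕_can` on `E[3^k·3]`, rows with `E(ℚ₃)[3] = 0` and `E(ℚ_w)[3] = 0` at the bad `w ≠ 3`) followed by F30's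
  `kolyvaginKimDatum_of_isKolyvaginSystem_canonicalStructure`. THEOREM D's binders are displayed verbatim (`hirr`, the
  canonical datum `D` with cyclotomic transverse conditions and THE canonical comparison maps, `𝒫 ⊆` the level primes and
  Kato's Kolyvagin primes of depth `k+1`, the row certificates `hbad` / `htors₃`, the reduction maps `rd`); F30's binders
  (Sakamoto's `(Sτ, τ)`, `vℓ ∈ 𝒫`, the divisibility witness) likewise. The two READINGS of the derived system — the
  bottom class `κ_∅ = κ(Q)` (Mazur–Rubin Thm. 5.2.12 in rank one + Kato's reciprocity law) and Kim's reading of `κ_{ℓ}`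
  at `v₃` (Kim Thm. 3.13 + (5.3), OPEN at `3`) — are ONE displayed hypothesis `hread` on EVERY system
  `(σ, Φ, κ)` satisfying THEOREM D's conclusion VERBATIM (generators `σ_q` in inertia with the pinned cyclotomic
  characters, the cocycle-level transports `Φ_r`, `κ` a Kolyvagin system for `𝓕_can` vanishing off the levels, and the
  derivative characterisation `res κ_r = ∏_{q ∈ r} D_q (Φ_r (red_* c_{ℚ(μ_r)}))`) — so the readings are statements
  about the DERIVATIVE CLASSES OF `c`, not about an unrelated Kolyvagin system.
* §2 **`kuriharaExactOrderAt_of_isEulerSystem_torsionCoeff`** — C-16's clause at `(ℓ, k₀)` ON ITS LETTER from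
  Poitou–Tate, the local Euler characteristic at `vℓ`, `v₃`, and, for every surjective `ψ`, THEOREM D's data + an Euler
  system with the two readings (`kuriharaExactOrderAt_of_kolyvaginKimDatum`, F25). `Irr(E[3])` is discharged from the
  letter's surjectivity (`hasIrreducibleModPGaloisRep_of_hasSurjectiveModNGaloisRep`). No closed sentence for C-16 is
  claimed beyond F30's: THEOREM D's bad-place certificate `hbad` is NOT part of C-16's letter, so it stays displayed here
  (the letter's `E(ℚ₃)[3] = 0` follows from `3` good non-anomalous but is also kept as the binder `htors₃` in the
  tree's `adicCompletion` currency).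

After this file the chain C-16 ⟸ … displays, on a letter with `hbad`: Poitou–Tate (Milne I 4.10(b)+2.3) ∧ local Euler
characteristic (Milne I 2.8) ∧ «an Euler system of `T_3E` over the cyclotomic levels whose derivative classes at depth
`k+1` have bottom class `κ((3^F·u)·P)` and Kim's reading at `3`» — Kato's Euler system (Astérisque 295, Thm. 8.1 / 12.5;
EXISTS in print, not asserted here) with Mazur–Rubin Thm. 5.2.12 and Kim Thm. 3.13 (print `p ≥ 5`; OPEN at `3`).

References: B. Mazur, K. Rubin, Mem. AMS 799 (2004), Def. 3.2.1, Thm. 3.2.4, Thm. 5.2.12, App. A [MazurRubin2004];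
K. Kato, Astérisque 295 (2004), Thm. 8.1, Thm. 12.5 [Kato2004Asterisque]; K. Rubin, *Euler Systems* (2000) Def. 2.1.1,
§4.4 [Rubin2000]; R. Sakamoto, JTNB 36 (2024) §2, Def. 4.1 [Sakamoto2024]; C.-H. Kim, arXiv:2203.12159, Thm. 3.13, (5.3)
[Kim2022StructureSelmer]; J. S. Milne, ADT (2006) I 2.8, 4.10(b) [MilneADT2006].
-/

noncomputable section

open CategoryTheory Function Finset Field IsDedekindDomain
open scoped NumberField Classical ContRepresentation MatrixGroups
open CongruenceSubgroup WeierstrassCurve Literature.NumberTheory.EllipticCurves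
  Literature.NumberTheory.EllipticCurves.ModularForms
  Literature.NumberTheory.EllipticCurves.Rank1Residual
  Literature.NumberTheory.GaloisRepresentations Literature.NumberTheory.GaloisCohomology
  Literature.NumberTheory.GaloisRepresentations.DiscreteGaloisModule
  NumberField
  Summit.BirchSwinnertonDyer.Rank1Residual.GaloisImage
  Summit.BirchSwinnertonDyer.Rank1Residual.GaloisImage.CoeffTransport
  Summit.BirchSwinnertonDyer.Rank1Residual.GaloisImage.CyclotomicLevel
  Summit.BirchSwinnertonDyer.Rank1Residual.GaloisImage.TorsionCoeff
  Rat.HeightOneSpectrum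

namespace Summit.BirchSwinnertonDyer.Rank1Residual.Ordinary

variable (W : WeierstrassCurve ℚ) [W.IsElliptic] [W.IsGloballyMinimal]
variable [Module.Free ℤ_[3] (W.tateModule 3)] [Module.Finite ℤ_[3] (W.tateModule 3)]
  [ContinuousSMul ℤ_[3] (W.tateModule 3)]

/-- Local notation: `T∞ = T_3 E` as a continuous `G_ℚ`-representation (as in n1011's THEOREM D files). -/
local notation3 "T∞" => WeierstrassCurve.tateGaloisRep W 3 (W.continuous_galoisRepTate_holds 3)

variable (S : Set (HeightOneSpectrum (𝓞 ℚ)))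

/-- Local notation: `𝓛` = the cyclotomic Euler-system levels `ℚ(μ_{3^{n+1}}, μ_r)`, `r ∩ S = ∅`. -/
local notation3 "𝓛" => cyclotomicLevelsRat 3 S

/-- Local notation: `𝐃ℤ⟦X, U, τ⟧ ℓ = ∑_{j < ℓ−1} j·(τ_ℓ)_*^j` on `H¹(U, X)` (`ℤ`-linear), Kolyvagin's derivative operator. -/
local notation3 (prettyPrint := false) "𝐃ℤ⟦" X ", " U ", " τ "⟧" =>
  fun ℓ : HeightOneSpectrum (𝓞 ℚ) =>
  ∑ j ∈ Finset.range (((primesEquiv ℓ : Nat.Primes) : ℕ) - 1),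
    (j : Module.End ℤ (continuousCohomology 1 (subgroupRep X U))) *
      (conjMap X U ((τ : HeightOneSpectrum (𝓞 ℚ) → absoluteGaloisGroup ℚ) ℓ) 1).hom.toLinearMap ^ j

/-- Local notation: the level-`j` reduction `red_j : T_3E ⟶ E[3^j]_{ℤ_3}` (n1011 GZ-2). -/
local notation3 "𝐫𝐞𝐝⟦" j "⟧" => tateModuleRed W 3 (W.continuous_galoisRepTate_holds 3) j

/-! ### §1 The datum from an Euler system of `T_3E` (THEOREM D ∘ F30) -/

section Datum

variable {N : ℕ} (f : CuspForm (Gamma0 N) 2) (ℓ k₀ k : ℕ) [Fact ℓ.Prime] (Q : W.toAffine.Point)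
  (vℓ vp : HeightOneSpectrum (𝓞 ℚ)) (ψ : (q : ℕ) → (ZMod q)ˣ →* Multiplicative (ZMod (3 ^ k₀)))

/-- **`KolyvaginKimDatum` at depth `k + 1` (prime `3`) from an EULER SYSTEM of `T_3E` over the cyclotomic levels.**
Binders: the Euler system `c` (`hc`; Kato's — NOT asserted), n1011's THEOREM D binders (`hirr`; the Kolyvagin datum `D` on
`E[3^k·3]` with cyclotomic transverse conditions `hT` and THE CANONICAL comparison maps `hD`; `hPr`, `hKol`; the row
certificates `hbad` (`E(ℚ_w)[3] = 0` at the bad `w ≠ 3`) and `htors₃` (`E(ℚ₃)[3] = 0`); the reduction maps `rd`/`hrd`),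
F30's binders (Sakamoto's `(Sτ, τ)`, `𝒫` in the `τ`-class, `vℓ ∈ 𝒫` good with `vℓ ∤ 3`, `vp ∋ 3`, the divisibility
witness `hdiv`), and ONE hypothesis `hread` on every system `(σ, Φ, κ)` satisfying THEOREM D's conclusion verbatim: its
bottom class is `κ(Q)` and its class `κ_{vℓ}` has Kim's reading at `vp`. Proof: THEOREM D
(`exists_isKolyvaginSystem_propagatedSelmerStructure_three_of_torsion_eq_zero_torsionCoeff`) produces `(σ, Φ, κ)`; `hread`
reads it; F30 `kolyvaginKimDatum_of_isKolyvaginSystem_canonicalStructure` concludes.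
[cite: MazurRubin2004, Thm. 3.2.4, Thm. 5.2.12 and App. A] [cite: Kim2022StructureSelmer, Thm. 3.13 and (5.3)]
[cite: Sakamoto2024, §2 (p. 921) and Def. 4.1 (p. 926)] -/
theorem kolyvaginKimDatum_of_isEulerSystem_torsionCoeff
    -- the Euler system and THEOREM D's binders
    {c : ∀ (i : ℕ) (r : (𝓛).Ideals), H1 T∞ ((𝓛).level i r.1)}
    (hc : IsEulerSystem 𝓛 T∞ 3 c) (hirr : W.HasIrreducibleModPGaloisRep 3)
    (D : KolyvaginDatum (W.torsionGaloisModule (((3 : ℕ) : ℤ) ^ k * ((3 : ℕ) : ℤ))))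
    (hT : D.transverse = cyclotomicTransverse (W.torsionGaloisModule (((3 : ℕ) : ℤ) ^ k * ((3 : ℕ) : ℤ))))
    {η : (q : HeightOneSpectrum (𝓞 ℚ)) → (ZMod (Ideal.absNorm q.asIdeal))ˣ}
    (hD : D.HasCanonicalComparison (3 ^ (k + 1)) η)
    (hPr : D.primes ⊆ (𝓛).primes)
    (hKol : ∀ q ∈ D.primes, Kato.IsKolyvaginPrime W 3 (k + 1) ((primesEquiv q : Nat.Primes) : ℕ))
    (hbad : ∀ w : HeightOneSpectrum (𝓞 ℚ), ¬ W.HasGoodReductionAt w →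
      ((primesEquiv w : Nat.Primes) : ℕ) ≠ 3 →
        ∀ P : (W.baseChange (w.adicCompletion ℚ)).toAffine.Point, 3 • P = 0 → P = 0)
    (htors₃ : ∀ v : HeightOneSpectrum (𝓞 ℚ), ((3 : ℕ) : 𝓞 ℚ) ∈ v.asIdeal →
      ∀ P : (W.baseChange (v.adicCompletion ℚ)).toAffine.Point, 3 • P = 0 → P = 0)
    (rd : ∀ j : ℕ, (W.torsionGaloisModule (((3 : ℕ) : ℤ) ^ (j + 1) * ((3 : ℕ) : ℤ))).toContRepresentation →ⁱL
      (W.torsionGaloisModule (((3 : ℕ) : ℤ) ^ j * ((3 : ℕ) : ℤ))).toContRepresentation)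
    (hrd : ∀ (j : ℕ) (x : geomTorsion W (((3 : ℕ) : ℤ) ^ (j + 1) * ((3 : ℕ) : ℤ))),
      ((rd j x : geomTorsion W (((3 : ℕ) : ℤ) ^ j * ((3 : ℕ) : ℤ))) : geomPoints W) =
        ((3 : ℕ) : ℤ) • (x : geomPoints W))
    -- F30's binders: Sakamoto's `τ`-class for the canonical datum, the place `vℓ`, the divisibility witness
    (Sτ : Set (HeightOneSpectrum (𝓞 ℚ))) {τ : absoluteGaloisGroup ℚ}
    (hτq : Nonempty (cokerSubOne (W.torsionGaloisModule (((3 : ℕ) : ℤ) ^ k * ((3 : ℕ) : ℤ))) τ ≃+ ZMod (3 ^ (k + 1))))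
    (hτμ : τ ∈ rootsOfUnityFixer ℚ (3 ^ (k + 1)))
    (hP : D.primes ⊆ frobeniusClassPrimes (W.torsionGaloisModule (((3 : ℕ) : ℤ) ^ k * ((3 : ℕ) : ℤ))) Sτ τ (3 ^ (k + 1)))
    (hDℓ : vℓ ∈ D.primes)
    (hdiv : ∀ X : geomPoints W, ∃ R : geomPoints W, (((3 : ℕ) : ℤ) ^ k * ((3 : ℕ) : ℤ)) • R = X)
    (hpv : ((3 : ℕ) : 𝓞 ℚ) ∉ vℓ.asIdeal) (hgood : W.HasGoodReductionAt vℓ) (hvp : ((3 : ℕ) : 𝓞 ℚ) ∈ vp.asIdeal)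
    -- the two READINGS of the derived system: bottom class (MR Thm. 5.2.12) and Kim's reading (Thm. 3.13 + (5.3))
    (hread : letI := TorsionCoeff.torsionBy.padicIntModule 3 (k + 1) (WeierstrassCurve.geomPoints W)
      ∀ (σ : HeightOneSpectrum (𝓞 ℚ) → absoluteGaloisGroup ℚ)
        (Φ : ∀ r : Finset (HeightOneSpectrum (𝓞 ℚ)),
          continuousCohomology 1 (subgroupRep (torsionRepPadicInt W 3 (k + 1)).toTopRep ((𝓛).level ⊥ r)) →+
            continuousCohomology 1 (subgroupRep
              (W.torsionGaloisModule (((3 : ℕ) : ℤ) ^ k * ((3 : ℕ) : ℤ))).toTopRep ((𝓛).level ⊥ r)))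
        (comm : ∀ r : Finset (HeightOneSpectrum (𝓞 ℚ)),
          ((r : Finset _) : Set (HeightOneSpectrum (𝓞 ℚ))).Pairwise fun a b =>
            Commute (𝐃ℤ⟦(W.torsionGaloisModule (((3 : ℕ) : ℤ) ^ k * ((3 : ℕ) : ℤ))).toTopRep, ((𝓛).level ⊥ r), σ⟧ a)
              (𝐃ℤ⟦(W.torsionGaloisModule (((3 : ℕ) : ℤ) ^ k * ((3 : ℕ) : ℤ))).toTopRep, ((𝓛).level ⊥ r), σ⟧ b))
        (κ : Finset (HeightOneSpectrum (𝓞 ℚ)) →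
          galoisCohomology (W.torsionGaloisModule (((3 : ℕ) : ℤ) ^ k * ((3 : ℕ) : ℤ))) 1),
        (∀ q, σ q ∈ (adicCompletionPrime ℚ q).inertia (absoluteGaloisGroup ℚ)) →
        (∀ q, modNCyclotomicCharacter ℚ (Ideal.absNorm q.asIdeal) (σ q) = η q) →
        (∀ r, ∀ (φ : contOneCocycles (subgroupRep (torsionRepPadicInt W 3 (k + 1)).toTopRep ((𝓛).level ⊥ r)))
          (ψ' : contOneCocycles (subgroupRep
            (W.torsionGaloisModule (((3 : ℕ) : ℤ) ^ k * ((3 : ℕ) : ℤ))).toTopRep ((𝓛).level ⊥ r))),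
          (∀ g, ψ'.1 g = AddSubgroup.inclusion (geomTorsion_pow_succ_eq W 3 k).le (φ.1 g)) →
            Φ r (oneCocycleClass _ φ) = oneCocycleClass _ ψ') →
        D.IsKolyvaginSystem (propagatedSelmerStructure W 3 k) κ →
        (∀ r : Finset (HeightOneSpectrum (𝓞 ℚ)), ¬ (↑r : Set _) ⊆ D.primes → κ r = 0) →
        (∀ (r : Finset (HeightOneSpectrum (𝓞 ℚ))) (hr : (↑r : Set _) ⊆ D.primes),
          resSubgroup (W.torsionGaloisModule (((3 : ℕ) : ℤ) ^ k * ((3 : ℕ) : ℤ))).toTopRep ((𝓛).level ⊥ r) 1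
              (κ r) =
            (r.noncommProd 𝐃ℤ⟦(W.torsionGaloisModule (((3 : ℕ) : ℤ) ^ k * ((3 : ℕ) : ℤ))).toTopRep,
                ((𝓛).level ⊥ r), σ⟧ (comm r))
              (Φ r (ContinuousCohomology.map (ContinuousMonoidHom.id _)
                (X := subgroupRep T∞.toTopRep ((𝓛).level ⊥ r))
                (Y := subgroupRep (torsionRepPadicInt W 3 (k + 1)).toTopRep ((𝓛).level ⊥ r))
                ((TopRep.resFunctor ((𝓛).level ⊥ r).subtype).map 𝐫𝐞𝐝⟦k + 1⟧) 1
                (c ⊥ ⟨r, fun _ hq => hPr (hr (Finset.mem_coe.2 hq))⟩)))) →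
        κ ∅ = kummerMapTorsion W (((3 : ℕ) : ℤ) ^ k * ((3 : ℕ) : ℤ)) hdiv Q ∧
        ∀ ψp : galoisCohomology ((W.torsionGaloisModule (((3 : ℕ) : ℤ) ^ k * ((3 : ℕ) : ℤ))).toLocal (Sum.inr vp)) 1 ⧸
            W.kummerSelmerStructure (((3 : ℕ) : ℤ) ^ k * ((3 : ℕ) : ℤ)) (Sum.inr vp) ≃+ ZMod (3 ^ (k + 1)),
          (haveI : NeZero ℓ := ⟨(Fact.out : ℓ.Prime).ne_zero⟩
           zmodPowOrd 3 k₀ (kuriharaNumber f (3 ^ k₀) ℓ ψ)) =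
            min k₀ (zmodPowOrd 3 (k + 1)
              (ψp (galoisCohomology.localization (W.torsionGaloisModule (((3 : ℕ) : ℤ) ^ k * ((3 : ℕ) : ℤ)))
                (Sum.inr vp) 1 (κ {vℓ}))))) :
    KolyvaginKimDatum W f 3 ℓ k₀ (k + 1) Q vℓ vp ψ := by
  letI := TorsionCoeff.torsionBy.padicIntModule 3 (k + 1) (WeierstrassCurve.geomPoints W)
  obtain ⟨σ, Φ, comm, κ, hσI, hσχ, hΦ, hKS, hκ0, hκc⟩ :=
    Derivative.Rat.exists_isKolyvaginSystem_propagatedSelmerStructure_three_of_torsion_eq_zero_torsionCoeff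
      W S hc k hirr D hT hD hPr hKol hbad htors₃ rd hrd
  obtain ⟨h1, hkim⟩ := hread σ Φ comm κ hσI hσχ hΦ hKS hκ0 hκc
  exact kolyvaginKimDatum_of_isKolyvaginSystem_canonicalStructure W f 3 ℓ k₀ k Q vℓ vp ψ (by decide) Sτ hτq hτμ
    hP hD hDℓ hdiv hpv hgood hvp hKS h1 hkim

end Datum

/-! ### §2 C-16's clause at `(ℓ, k₀)` on its letter from an Euler system of `T_3E` -/

section Letter

variable {N : ℕ} (f : CuspForm (Gamma0 N) 2) (ℓ k₀ : ℕ) [Fact ℓ.Prime] (P : W.toAffine.Point) (F : ℕ)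

/-- **C-16's clause at `(ℓ, k₀)` ON ITS LETTER from an Euler system of `T_3E`** (`p = 3`, `m₃(P) = 0`; exponent `F`):
Poitou–Tate over `ℚ`, the local Euler characteristic at `vℓ` and `v₃`, the letter clauses (`3` good, `a₃ ∉ {1, −2}`,
`m₃(P) = 0`, `ℓ` a cyclic Kolyvagin level, `ρ̄_{E,3}` onto — which gives `Irr(E[3])` for THEOREM D), the curve-level
certificates of n1011's THEOREM D DISPLAYED (`hbad`: `E(ℚ_w)[3] = 0` at the bad `w ≠ 3` — NOT a clause of C-16's letter;
`htors₃`: `E(ℚ₃)[3] = 0` in the `adicCompletion` currency; the reduction maps `rd`), and for every surjective `ψ`: a depth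
`k + 1 ≥ k₀` with `ℓ ∈ 𝒫_{k+1}`, a unit `u`, the excluded set `S` of the cyclotomic levels, an EULER SYSTEM `c` of `T_3E`
over `ℚ(μ_{3^{n+1}}, μ_r)` (Kato's — a binder, NOT asserted), THE CANONICAL Kolyvagin datum on `E[3^k·3]` (cyclotomic
transverse conditions, canonical comparison maps, primes among the level primes and Kato's Kolyvagin primes, in a Sakamoto
`τ`-class, containing `vℓ`), a divisibility witness, and the READING hypothesis on every derived system `(σ, Φ, κ)` of `c`
(THEOREM D's conclusion verbatim ⟹ bottom class `κ((3^F·u)·P)` and Kim's reading of `κ_{vℓ}` at `v₃`) — give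
`KuriharaExactOrderAt W f ℓ k₀ P F` (§1 + F25 `kuriharaExactOrderAt_of_kolyvaginKimDatum`). Nothing asserted; C-16 stays a
CONJECTURE; no closed sentence beyond F30's is claimed (THEOREM D's `hbad` is not in the letter).
[cite: MazurRubin2004, Thm. 3.2.4, Thm. 5.2.12 and App. A] [cite: Kim2022StructureSelmer, Thm. 3.13 and (5.3)]
[cite: MilneADT2006, Ch. I, Thm. 4.10(b) and Thm. 2.8] [cite: Sakamoto2024, §2 (p. 921) and Def. 4.1 (p. 926)] -/
theorem kuriharaExactOrderAt_of_isEulerSystem_torsionCoeff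
    (hgood : W.HasGoodReductionAtPrime 3) (ha1 : W.frobeniusTrace 3 ≠ 1) (ha2 : W.frobeniusTrace 3 ≠ -2)
    (hm0 : ¬ O5.PointLocallyThreeDivisibleAt W 3 P) (hcycℓ : IsCyclicKolyvaginLevel W 3 ℓ)
    {vℓ v₃ : HeightOneSpectrum (𝓞 ℚ)} (hvℓ : (ℓ : 𝓞 ℚ) ∈ vℓ.asIdeal) (hv₃ : ((3 : ℕ) : 𝓞 ℚ) ∈ v₃.asIdeal)
    (hPT : poitouTate_sum_localTatePairing_eq_zero ℚ)
    (hEPℓ : localEulerPoincareCharacteristic (vℓ.adicCompletion ℚ))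
    (hEP₃ : localEulerPoincareCharacteristic (v₃.adicCompletion ℚ))
    -- curve-level inputs of THEOREM D: `Irr(E[3])` from the letter's surjectivity; the certificates are DISPLAYED
    (hsurj : W.HasSurjectiveModNGaloisRep ((3 : ℕ) : ℤ))
    (hbad : ∀ w : HeightOneSpectrum (𝓞 ℚ), ¬ W.HasGoodReductionAt w →
      ((primesEquiv w : Nat.Primes) : ℕ) ≠ 3 →
        ∀ P : (W.baseChange (w.adicCompletion ℚ)).toAffine.Point, 3 • P = 0 → P = 0)
    (htors₃ : ∀ v : HeightOneSpectrum (𝓞 ℚ), ((3 : ℕ) : 𝓞 ℚ) ∈ v.asIdeal →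
      ∀ P : (W.baseChange (v.adicCompletion ℚ)).toAffine.Point, 3 • P = 0 → P = 0)
    (rd : ∀ j : ℕ, (W.torsionGaloisModule (((3 : ℕ) : ℤ) ^ (j + 1) * ((3 : ℕ) : ℤ))).toContRepresentation →ⁱL
      (W.torsionGaloisModule (((3 : ℕ) : ℤ) ^ j * ((3 : ℕ) : ℤ))).toContRepresentation)
    (hrd : ∀ (j : ℕ) (x : geomTorsion W (((3 : ℕ) : ℤ) ^ (j + 1) * ((3 : ℕ) : ℤ))),
      ((rd j x : geomTorsion W (((3 : ℕ) : ℤ) ^ j * ((3 : ℕ) : ℤ))) : geomPoints W) =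
        ((3 : ℕ) : ℤ) • (x : geomPoints W))
    -- per surjective `ψ`: the depth, the unit, the Euler system, the canonical datum, the readings
    (h : ∀ ψ : (q : ℕ) → (ZMod q)ˣ →* Multiplicative (ZMod (3 ^ k₀)),
      (∀ q ∈ ℓ.primeFactors, Function.Surjective (ψ q)) →
        ∃ (k : ℕ) (_ : k₀ ≤ k + 1) (_ : Kato.IsKolyvaginPrime W 3 (k + 1) ℓ) (u : ℕ) (_ : ¬ 3 ∣ u)
          (S : Set (HeightOneSpectrum (𝓞 ℚ)))
          (c : ∀ (i : ℕ) (r : (cyclotomicLevelsRat 3 S).Ideals), H1 T∞ ((cyclotomicLevelsRat 3 S).level i r.1))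
          (_ : IsEulerSystem (cyclotomicLevelsRat 3 S) T∞ 3 c)
          (D : KolyvaginDatum (W.torsionGaloisModule (((3 : ℕ) : ℤ) ^ k * ((3 : ℕ) : ℤ))))
          (_ : D.transverse = cyclotomicTransverse (W.torsionGaloisModule (((3 : ℕ) : ℤ) ^ k * ((3 : ℕ) : ℤ))))
          (η : (q : HeightOneSpectrum (𝓞 ℚ)) → (ZMod (Ideal.absNorm q.asIdeal))ˣ)
          (_ : D.HasCanonicalComparison (3 ^ (k + 1)) η)
          (hPr : D.primes ⊆ (cyclotomicLevelsRat 3 S).primes)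
          (_ : ∀ q ∈ D.primes, Kato.IsKolyvaginPrime W 3 (k + 1) ((primesEquiv q : Nat.Primes) : ℕ))
          (Sτ : Set (HeightOneSpectrum (𝓞 ℚ))) (τ : absoluteGaloisGroup ℚ)
          (_ : Nonempty (cokerSubOne (W.torsionGaloisModule (((3 : ℕ) : ℤ) ^ k * ((3 : ℕ) : ℤ))) τ ≃+
            ZMod (3 ^ (k + 1))))
          (_ : τ ∈ rootsOfUnityFixer ℚ (3 ^ (k + 1)))
          (_ : D.primes ⊆ frobeniusClassPrimes (W.torsionGaloisModule (((3 : ℕ) : ℤ) ^ k * ((3 : ℕ) : ℤ))) Sτ τ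
            (3 ^ (k + 1)))
          (_ : vℓ ∈ D.primes)
          (hdiv : ∀ X : geomPoints W, ∃ R : geomPoints W, (((3 : ℕ) : ℤ) ^ k * ((3 : ℕ) : ℤ)) • R = X),
          (letI := TorsionCoeff.torsionBy.padicIntModule 3 (k + 1) (WeierstrassCurve.geomPoints W)
            ∀ (σ : HeightOneSpectrum (𝓞 ℚ) → absoluteGaloisGroup ℚ)
              (Φ : ∀ r : Finset (HeightOneSpectrum (𝓞 ℚ)),
                continuousCohomology 1 (subgroupRep (torsionRepPadicInt W 3 (k + 1)).toTopRep
                  ((cyclotomicLevelsRat 3 S).level ⊥ r)) →+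
                  continuousCohomology 1 (subgroupRep
                    (W.torsionGaloisModule (((3 : ℕ) : ℤ) ^ k * ((3 : ℕ) : ℤ))).toTopRep
                    ((cyclotomicLevelsRat 3 S).level ⊥ r)))
              (comm : ∀ r : Finset (HeightOneSpectrum (𝓞 ℚ)),
                ((r : Finset _) : Set (HeightOneSpectrum (𝓞 ℚ))).Pairwise fun a b =>
                  Commute
                    (𝐃ℤ⟦(W.torsionGaloisModule (((3 : ℕ) : ℤ) ^ k * ((3 : ℕ) : ℤ))).toTopRep,
                      ((cyclotomicLevelsRat 3 S).level ⊥ r), σ⟧ a)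
                    (𝐃ℤ⟦(W.torsionGaloisModule (((3 : ℕ) : ℤ) ^ k * ((3 : ℕ) : ℤ))).toTopRep,
                      ((cyclotomicLevelsRat 3 S).level ⊥ r), σ⟧ b))
              (κ : Finset (HeightOneSpectrum (𝓞 ℚ)) →
                galoisCohomology (W.torsionGaloisModule (((3 : ℕ) : ℤ) ^ k * ((3 : ℕ) : ℤ))) 1),
              (∀ q, σ q ∈ (adicCompletionPrime ℚ q).inertia (absoluteGaloisGroup ℚ)) →
              (∀ q, modNCyclotomicCharacter ℚ (Ideal.absNorm q.asIdeal) (σ q) = η q) →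
              (∀ r, ∀ (φ : contOneCocycles (subgroupRep (torsionRepPadicInt W 3 (k + 1)).toTopRep
                  ((cyclotomicLevelsRat 3 S).level ⊥ r)))
                (ψ' : contOneCocycles (subgroupRep
                  (W.torsionGaloisModule (((3 : ℕ) : ℤ) ^ k * ((3 : ℕ) : ℤ))).toTopRep
                  ((cyclotomicLevelsRat 3 S).level ⊥ r))),
                (∀ g, ψ'.1 g = AddSubgroup.inclusion (geomTorsion_pow_succ_eq W 3 k).le (φ.1 g)) →
                  Φ r (oneCocycleClass _ φ) = oneCocycleClass _ ψ') →
              D.IsKolyvaginSystem (propagatedSelmerStructure W 3 k) κ →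
              (∀ r : Finset (HeightOneSpectrum (𝓞 ℚ)), ¬ (↑r : Set _) ⊆ D.primes → κ r = 0) →
              (∀ (r : Finset (HeightOneSpectrum (𝓞 ℚ))) (hr : (↑r : Set _) ⊆ D.primes),
                resSubgroup (W.torsionGaloisModule (((3 : ℕ) : ℤ) ^ k * ((3 : ℕ) : ℤ))).toTopRep
                    ((cyclotomicLevelsRat 3 S).level ⊥ r) 1 (κ r) =
                  (r.noncommProd 𝐃ℤ⟦(W.torsionGaloisModule (((3 : ℕ) : ℤ) ^ k * ((3 : ℕ) : ℤ))).toTopRep,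
                      ((cyclotomicLevelsRat 3 S).level ⊥ r), σ⟧ (comm r))
                    (Φ r (ContinuousCohomology.map (ContinuousMonoidHom.id _)
                      (X := subgroupRep T∞.toTopRep ((cyclotomicLevelsRat 3 S).level ⊥ r))
                      (Y := subgroupRep (torsionRepPadicInt W 3 (k + 1)).toTopRep
                        ((cyclotomicLevelsRat 3 S).level ⊥ r))
                      ((TopRep.resFunctor ((cyclotomicLevelsRat 3 S).level ⊥ r).subtype).map 𝐫𝐞𝐝⟦k + 1⟧) 1
                      (c ⊥ ⟨r, fun _ hq => hPr (hr (Finset.mem_coe.2 hq))⟩)))) →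
              κ ∅ = kummerMapTorsion W (((3 : ℕ) : ℤ) ^ k * ((3 : ℕ) : ℤ)) hdiv ((3 ^ F * u) • P) ∧
              ∀ ψp : galoisCohomology ((W.torsionGaloisModule (((3 : ℕ) : ℤ) ^ k * ((3 : ℕ) : ℤ))).toLocal
                    (Sum.inr v₃)) 1 ⧸
                  W.kummerSelmerStructure (((3 : ℕ) : ℤ) ^ k * ((3 : ℕ) : ℤ)) (Sum.inr v₃) ≃+ ZMod (3 ^ (k + 1)),
                (haveI : NeZero ℓ := ⟨(Fact.out : ℓ.Prime).ne_zero⟩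
                 zmodPowOrd 3 k₀ (kuriharaNumber f (3 ^ k₀) ℓ ψ)) =
                  min k₀ (zmodPowOrd 3 (k + 1)
                    (ψp (galoisCohomology.localization (W.torsionGaloisModule (((3 : ℕ) : ℤ) ^ k * ((3 : ℕ) : ℤ)))
                      (Sum.inr v₃) 1 (κ {vℓ})))))) :
    KuriharaExactOrderAt W f ℓ k₀ P F := by
  have hirr : W.HasIrreducibleModPGaloisRep 3 := hasIrreducibleModPGaloisRep_of_hasSurjectiveModNGaloisRep W 3 hsurj
  refine kuriharaExactOrderAt_of_kolyvaginKimDatum W f ℓ k₀ P F hgood ha1 ha2 hm0 hcycℓ hvℓ hv₃ hPT hEPℓ hEP₃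
    fun ψ hψ => ?_
  obtain ⟨k, hk, hKP, u, hu, S, c, hc, D, hT, η, hD, hPr, hKol, Sτ, τ, hτq, hτμ, hP, hDℓ, hdiv, hread⟩ := h ψ hψ
  obtain ⟨hpv, hgoodℓ⟩ := IsKolyvaginPrime.not_mem_and_hasGoodReductionAt W hKP hvℓ
  exact ⟨k + 1, hk, hKP, u, hu, kolyvaginKimDatum_of_isEulerSystem_torsionCoeff W S f ℓ k₀ k _ vℓ v₃ ψ hc hirr D hT
    hD hPr hKol hbad htors₃ rd hrd Sτ hτq hτμ hP hDℓ hdiv hpv hgoodℓ hv₃ hread⟩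

end Letter

end Summit.BirchSwinnertonDyer.Rank1Residual.Ordinary

end
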